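import Summits.QuantumFields.BalabanUV.Beta.EriceRemainderEnclosureHistoryAutonomyComparisonAgeCompositionNestedReads
import Summits.QuantumFields.BalabanUV.Beta.EriceRemainderEnclosureHistoryAutonomyComparisonAgeCompositionPairShares

/-!
# EriceRemainderEnclosureHistoryAutonomyComparisonAgeCompositionNestedMoments — (E92c) route (N), first order: NESTED SLOW READS WITH THE FIRST MOMENT OF
# THE READING ROW, AND THE CENSUS THREE AGES AT EVERY OLD RATIO ONCE THE MIDDLE AGE IS OLD: `{1, k₂, k₃}`, EVERY `k₃ > k₂ ≥ 230` — `0 ≤ ε ≤ e` ALONG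
# EVERY ADMISSIBLE FLOW, EVERY HORIZON, EVERY DAMPING OF THE SELF-CONSISTENT CLASS, NO DISPLAYED MARGIN.  The residual step of (E92a) charges the
# variation of the older read at its MAXIMUM over the young window; charging it per lag against the first moment `Σ_l w_l·(l+1) ≤ c·n(n+1)∕2` of the
# reading row halves the middle term (`(j+1)∕k` instead of `2j∕k`): the hierarchical wedge becomes `40(i+1)(j+k) + 12j(j+1) ≤ jk` (`{1,k₂,k₃}`:
# `80(k₂+k₃) + 12k₂(k₂+1) ≤ k₂k₃`, ratio `→ 12`), which from `k₂ ≥ 229` covers every `k₃ ≥ 19(k₂+1)` — and (E92b)'s discharged wedge R1 covers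
# `k₃ + 1 ≤ 19(k₂+1)` from `k₂ ≥ 230`: the two meet

Cell `pub-balaban`, β-function sub-cell, BINDER row D4 «RemainderConst leaves for Bałaban's split» (`HOME/BINDER-OWNERS.md`; owner lineage `b2b-balaban-beta-an4`;
this file by co-owner #2 lineage `b2b-balaban-beta-d4-p2`, generation 83), β-FLOW TEAM duty (1), FREEZE (0) honoured (def-free; nothing restated).

HONEST FRAMING (page 1, verbatim and binding).  *"Discharging BetaPertH makes Bałaban's UV stability UNCONDITIONAL — a real constructive-QFT result; it is
NOT the continuum limit and NOT the Clay problem."*  THIS FILE DISCHARGES NOTHING OF THE KIND.  Elementary real algebra ∕ real analysis about ABSTRACT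
functionals on a box ]0,γ]^ℕ with displayed floors, profiles and signs, and the FIRST-ORDER renewal objects of route (N) built from them — hypotheses of a
census, not facts; the form, signs, ages and moments of Bałaban's (1.22) limit functional are NOT PRINTED ([I] p. 298; GAPS G-t4-U2-1∕-2) and NOT asserted.
Row D4 class UNCHANGED (critical-path width 0; instance 0∕1; D4 DISCHARGE NO DATE).  HONEST DEPENDENCY: continuum YM on T⁴ ⇐ BetaPertH ∧ nine spine
estimates (0/9 proved); BetaPertH ⇐ (D1) ∧ (D4) ∧ CAP+tail; G-an2-4 gates asym, D1 and NE2/3/4.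

THE POINT (README `HOME/b2b-balaban-beta-d4-p2/g83/e92/README.md` §1–§3).  README g82∕e91 §2(c): three ages at every ratio were out of reach of ONE
contraction; the coverage was `R0 = {k₃ ≤ 56}` plus two wedges with displayed margins.  (E92a) nests the contraction, (E92b) discharges the wedges;
here the nested wedge is sharpened by the first moment of the reading row (`residual_step_moment`, `row_moment_le`) and JOINED to the discharged
wedge R1: **`flow_nonneg_census_three_ages_old_middle`** — for the census three ages `{1, k₂, k₃}` with `k₂ ≥ 230`, EVERY `k₃ > k₂`, every
admissible flow, every horizon, every damping with `g_t(1+F_t) ≥ 1`: `0 ≤ ε ≤ e`.  With (E90c) (`k₃ ≤ 56`, every `k₂`) the census three ages are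
now closed outside the bounded strip `2 ≤ k₂ ≤ 229`, `k₃ ≥ 57` minus the discharged wedges (README §3 tabulates what is left: R2 for `k₂ ≤ 66` and
far `k₃`, the nested wedge for `81 ≤ k₂`, R1 near the diagonal for `k₂ ≳ 40`).  Uses (E92a) `renewal_bounds_of_step`, (E92b)
`flow_nonneg_census_three_ages_ratio_le`, (E91a) `old_read_variation`, (E82a) `kernel_entry_le`∕`row_mass_le`, (E89b)
`window_load_le_sqrt_two_div_two`, (E80b) `aggregate_eq_sum` BY NAME.  NOT CLAIMED: `k₂ ≤ 229` beyond the wedges; four or more ages; anything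
printed — NOT B12 Thm 2, NOT BetaPertH.

WHAT IS PROVED ([folklore]; 0 `def`, 0 sorry).  §1 (pure) **`residual_step_moment`**, `sum_range_succ_real`, `row_moment_le`, `nested_numerics_moment`.
§2 **`flow_nonneg_three_ages_nested_moment`** (`40(i+1)(j+k) + 12j(j+1) ≤ jk`), `flow_nonneg_census_three_ages_nested_moment`
(`80(k₂+k₃) + 12k₂(k₂+1) ≤ k₂k₃`).  §3 **`flow_nonneg_census_three_ages_old_middle`** (`230 ≤ k₂ < k₃ < K`: every old age).
-/
noncomputable section
open Finset

namespace Summit.QuantumFields.BalabanUV.Beta.EriceRemainderEnclosureHistoryAutonomyComparisonAgeCompositionNestedMoments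

open Literature.MathematicalPhysics.QuantumFieldTheory.Balaban1983to89
open Literature.MathematicalPhysics.QuantumFieldTheory.Balaban1983to89.T4BetaStationary
open Literature.MathematicalPhysics.QuantumFieldTheory.Balaban1983to89.T4BetaFlowWellPosed
open Summit.QuantumFields.BalabanUV.Beta.EriceRemainderEnclosureHistoryAutonomyComparisonAgeCompositionTwoAgesOldRead (old_read_variation)
open Summit.QuantumFields.BalabanUV.Beta.EriceRemainderEnclosureHistoryAutonomyComparisonAgeCompositionThreeAgesMassCap
  (window_load_le_sqrt_two_div_two)
open Summit.QuantumFields.BalabanUV.Beta.EriceRemainderEnclosureHistoryAutonomyComparisonAgeCompositionYoungestTailSumFlow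
  (kernel_entry_le row_mass_le)
open Summit.QuantumFields.BalabanUV.Beta.EriceRemainderEnclosureHistoryAutonomyComparisonAgeCompositionChainWiring (aggregate_eq_sum)
open Summit.QuantumFields.BalabanUV.Beta.EriceRemainderEnclosureHistoryAutonomyComparisonAgeCompositionNestedReads (renewal_bounds_of_step)
open Summit.QuantumFields.BalabanUV.Beta.EriceRemainderEnclosureHistoryAutonomyComparisonAgeCompositionPairShares
  (flow_nonneg_census_three_ages_ratio_le)

variable {B : (ℕ → ℝ) → ℝ} {γ b gIR : ℝ} {L : ℕ → ℝ} {K : ℕ} {h g : ℕ → ℝ}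

/-! ## §1 The residual step charged against the first moment of the reading row -/

/-- **THE RESIDUAL STEP WITH THE FIRST MOMENT (pure, one pin).**  As (E92a) `residual_step`, but the older read's variation is charged PER LAG:
`O_m − O_{m+d} ≤ V·d·e_m` (`1 ≤ d ≤ i`) against the first moment `Σ_l wy_l·(l+1) ≤ M₁` of the young row.  Then
`e_m − O_m − Y ≥ (1 − sy)(e_m − O_m) − M₁·V·e_m`. [folklore] -/
theorem residual_step_moment {i Kw m : ℕ} {sy V M₁ : ℝ} {wy : ℕ → ℝ} {O e ε : ℕ → ℝ}
    (hwy0 : ∀ l, 0 ≤ wy l) (hwyi : ∀ l, i ≤ l → wy l = 0) (hWy : ∑ l ∈ range Kw, wy l ≤ sy)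
    (hM : ∑ l ∈ range Kw, wy l * ((l : ℝ) + 1) ≤ M₁) (hV : 0 ≤ V)
    (he0 : ∀ m, 0 ≤ e m) (hea : ∀ m, e (m + 1) ≤ e m)
    (htarget : ∀ q, m < q → ε q ≤ e q - O q) (hres : 0 ≤ e m - O m)
    (hvar : ∀ d, 1 ≤ d → d ≤ i → O m - O (m + d) ≤ V * d * e m) :
    (1 - sy) * (e m - O m) - M₁ * V * e m ≤ e m - O m - ∑ l ∈ range Kw, wy l * ε (m + 1 + l) := by
  have hea' : ∀ p q, p ≤ q → e q ≤ e p := by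
    intro p q hpq
    induction q, hpq using Nat.le_induction with
    | base => exact le_rfl
    | succ q _ ih => exact (hea q).trans ih
  set Wy := ∑ l ∈ range Kw, wy l with hWy_def
  -- the young targets carry the older read
  have hYle : ∑ l ∈ range Kw, wy l * ε (m + 1 + l) ≤ Wy * e m - ∑ l ∈ range Kw, wy l * O (m + 1 + l) := by
    rw [hWy_def, sum_mul, ← sum_sub_distrib]
    refine sum_le_sum fun l _ => ?_
    by_cases hl : l < i
    · have h1 := htarget (m + 1 + l) (by omega)
      have h2 := hea' m (m + 1 + l) (by omega)
      have h3 := hwy0 l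
      nlinarith
    · rw [hwyi l (not_lt.mp hl)]; simp
  -- the older read's variation, charged per lag against the first moment
  have hvar' : ∑ l ∈ range Kw, wy l * (O m - O (m + 1 + l)) ≤ M₁ * (V * e m) := by
    have h1 : ∑ l ∈ range Kw, wy l * (O m - O (m + 1 + l)) ≤ ∑ l ∈ range Kw, wy l * ((l : ℝ) + 1) * (V * e m) := by
      refine sum_le_sum fun l _ => ?_
      by_cases hl : l < i
      · have := hvar (l + 1) (by omega) (by omega)
        rw [show m + 1 + l = m + (l + 1) by ring]
        have h2 : O m - O (m + (l + 1)) ≤ ((l : ℝ) + 1) * (V * e m) := by push_cast at this; linarith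
        have := mul_le_mul_of_nonneg_left h2 (hwy0 l)
        linarith
      · rw [hwyi l (not_lt.mp hl)]; simp
    rw [← sum_mul] at h1
    exact h1.trans (mul_le_mul_of_nonneg_right hM (mul_nonneg hV (he0 m)))
  have hsum : ∑ l ∈ range Kw, wy l * O (m + 1 + l) = Wy * O m - ∑ l ∈ range Kw, wy l * (O m - O (m + 1 + l)) := by
    rw [hWy_def, sum_mul, ← sum_sub_distrib]
    exact sum_congr rfl fun l _ => by ring
  have key : (1 - Wy) * (e m - O m) - M₁ * (V * e m) ≤ e m - O m - ∑ l ∈ range Kw, wy l * ε (m + 1 + l) := by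
    linarith [hYle, hvar', hsum]
  have h1 : (1 - sy) * (e m - O m) ≤ (1 - Wy) * (e m - O m) := mul_le_mul_of_nonneg_right (by linarith) hres
  linarith

/-- `Σ_{l<a} (l+1) = a(a+1)∕2`. [folklore] -/
theorem sum_range_succ_real (a : ℕ) : ∑ l ∈ range a, ((l : ℝ) + 1) = (a : ℝ) * ((a : ℝ) + 1) / 2 := by
  induction a with
  | zero => simp
  | succ a ih => rw [sum_range_succ, ih]; push_cast; ring

/-- **THE FIRST MOMENT OF A DAMPED ROW**: `Σ_{l<K} KL a m l·(l+1) ≤ (L_ah_{m+a}³∕2)·a(a+1)∕2` for `a < K` ((E82a) `kernel_entry_le`). [folklore] -/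
theorem row_moment_le (hL : ∀ k, 0 ≤ L k) (hh : SeqBox γ h) (hg : ∀ t, 0 < g t ∧ g t ≤ 1) {KL : ℕ → ℕ → ℕ → ℝ}
    (hKL : ∀ k n l, KL k n l = if 0 < k ∧ k < K ∧ l < k then L k * h (n + k) ^ 3 / 2 * ∏ t ∈ Ico (n + 1 + l) (n + k + 1), g t else 0)
    {a : ℕ} (haK : a < K) (m : ℕ) :
    ∑ l ∈ range K, KL a m l * ((l : ℝ) + 1) ≤ (L a * h (m + a) ^ 3 / 2) * ((a : ℝ) * ((a : ℝ) + 1) / 2) := by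
  rw [← sum_range_add_sum_Ico _ haK.le]
  have h1 : ∑ l ∈ range a, KL a m l * ((l : ℝ) + 1) ≤ ∑ l ∈ range a, L a * h (m + a) ^ 3 / 2 * ((l : ℝ) + 1) :=
    sum_le_sum fun l hl => mul_le_mul_of_nonneg_right
      (by have := (kernel_entry_le hL hh hg hKL a m l).2; rwa [if_pos (mem_range.mp hl)] at this) (by positivity)
  have h2 : ∑ l ∈ Ico a K, KL a m l * ((l : ℝ) + 1) = 0 := sum_eq_zero fun l hl => by
    have hle := (kernel_entry_le hL hh hg hKL a m l).2
    rw [if_neg (not_lt.mpr (mem_Ico.mp hl).1)] at hle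
    rw [le_antisymm hle (kernel_entry_le hL hh hg hKL a m l).1, zero_mul]
  rw [h2, add_zero, ← sum_range_succ_real a, mul_sum]
  exact h1

/-- **THE NUMERICS OF THE SHARPENED WEDGE.**  `40(i+1)(j+k) + 12j(j+1) ≤ jk` with `j, k > 0` gives
`0 ≤ (1 − √2∕2)³ − (1 − √2∕2)·((j+1)∕k) − (i+1)∕j − (i+1)∕k` (`√2 ≤ 99∕70`: `40·(41∕140)³ ≥ 1`, `12·(41∕140)² ≥ 1`). [folklore] -/
theorem nested_numerics_moment {i j k : ℕ} (hj : 0 < j) (hk : 0 < k) (hcond : 40 * (i + 1) * (j + k) + 12 * j * (j + 1) ≤ j * k) :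
    0 ≤ (1 - Real.sqrt 2 / 2) ^ 3 - (1 - Real.sqrt 2 / 2) * (((j : ℝ) + 1) / k) - ((i : ℝ) + 1) / j - ((i : ℝ) + 1) / k := by
  have hs99 : Real.sqrt 2 ≤ 99 / 70 := Real.sqrt_le_iff.mpr ⟨by norm_num, by norm_num⟩
  have hs1 : (1 : ℝ) ≤ Real.sqrt 2 := by rw [Real.le_sqrt (by norm_num) (by norm_num)]; norm_num
  have hi0 : (0 : ℝ) ≤ i := Nat.cast_nonneg i
  have hjr : (0 : ℝ) < j := by exact_mod_cast hj
  have hkr : (0 : ℝ) < k := by exact_mod_cast hk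
  have hc : (40 : ℝ) * (i + 1) * (j + k) + 12 * j * (j + 1) ≤ j * k := by exact_mod_cast hcond
  set c : ℝ := 1 - Real.sqrt 2 / 2 with hc_def
  have hc0 : (41 : ℝ) / 140 ≤ c := by rw [hc_def]; linarith
  have hc1 : c ≤ 1 / 2 := by rw [hc_def]; linarith
  -- (j+1)∕k ≤ 1∕12 ≤ (41∕140)² ≤ c²
  have hjk : 12 * ((j : ℝ) + 1) ≤ k := by
    have h0 : (0 : ℝ) ≤ 40 * ((i : ℝ) + 1) * ((j : ℝ) + k) := by positivity
    have h1 : (j : ℝ) * (12 * ((j : ℝ) + 1)) ≤ (j : ℝ) * k := by linarith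
    exact le_of_mul_le_mul_left h1 hjr
  have h12 : ((j : ℝ) + 1) / k ≤ 1 / 12 := by rw [div_le_iff₀ hkr]; linarith
  have hA0 : 0 ≤ ((41 : ℝ) / 140) ^ 2 - ((j : ℝ) + 1) / k := by nlinarith
  have hmono : ((41 : ℝ) / 140) * (((41 : ℝ) / 140) ^ 2 - ((j : ℝ) + 1) / k) ≤ c * (c ^ 2 - ((j : ℝ) + 1) / k) := by
    have h1 : ((41 : ℝ) / 140) ^ 2 - ((j : ℝ) + 1) / k ≤ c ^ 2 - ((j : ℝ) + 1) / k := by nlinarith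
    calc ((41 : ℝ) / 140) * (((41 : ℝ) / 140) ^ 2 - ((j : ℝ) + 1) / k) ≤ ((41 : ℝ) / 140) * (c ^ 2 - ((j : ℝ) + 1) / k) :=
          mul_le_mul_of_nonneg_left h1 (by norm_num)
      _ ≤ c * (c ^ 2 - ((j : ℝ) + 1) / k) := mul_le_mul_of_nonneg_right hc0 (by linarith)
  have hcore : 0 ≤ ((41 : ℝ) / 140) * (((41 : ℝ) / 140) ^ 2 - ((j : ℝ) + 1) / k) - ((i : ℝ) + 1) / j - ((i : ℝ) + 1) / k := by
    have hjk0 : (0 : ℝ) < (j : ℝ) * k := mul_pos hjr hkr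
    have e : ((41 : ℝ) / 140) * (((41 : ℝ) / 140) ^ 2 - ((j : ℝ) + 1) / k) - ((i : ℝ) + 1) / j - ((i : ℝ) + 1) / k
        = (((41 : ℝ) / 140) ^ 3 * (j * k) - (41 / 140) * (j * (j + 1)) - (i + 1) * k - (i + 1) * j) / (j * k) := by
      field_simp
    rw [e]
    exact div_nonneg (by nlinarith) hjk0.le
  have e3 : c ^ 3 - c * (((j : ℝ) + 1) / k) = c * (c ^ 2 - ((j : ℝ) + 1) / k) := by ring
  rw [e3]
  linarith

/-! ## §2 The sharpened hierarchical wedge along flows -/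
set_option maxHeartbeats 400000 in
/-- **THREE AGES `i ≪ j ≪ k`, SHARPENED: `40(i+1)(j+k) + 12j(j+1) ≤ jk` ⟹ THE END ALONG EVERY FLOW** (every horizon, every damping of the
self-consistent class, whatever the total load; profile carried by `{i, j, k}`, `1 ≤ i < j < k < K`).  As (E92a) `flow_nonneg_three_ages_nested`, with
both residual steps charged against the first moments of the reading rows (`row_moment_le`): the middle residual is `(1−√2∕2)² − (j+1)∕k`, the young
correction `(i+1)(1∕j + 1∕k)`. [folklore] -/
theorem flow_nonneg_three_ages_nested_moment (hmono : ∀ u v : ℕ → ℝ, SeqBox γ u → SeqBox γ v → (∀ j, u j ≤ v j) → B u ≤ B v)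
    (hL : ∀ k, 0 ≤ L k) (hb : 0 < b) (hlo : ∀ u, SeqBox γ u → b ≤ B u) (hdom : ∀ u, SeqBox γ u → ∑ k ∈ range K, L k * u k ≤ B u)
    (hh : SeqBox γ h) (hf : MemFlow B gIR h) (hg : ∀ t, 0 < g t ∧ g t ≤ 1)
    (hgF : ∀ t, 1 ≤ g t * (1 + ∑ k ∈ range K, L k * h (t + k) ^ 3 / 2))
    {i j k : ℕ} (hi : 1 ≤ i) (hij : i < j) (hjk : j < k) (hkK : k < K) (hL3 : ∀ l, l < K → l ≠ i → l ≠ j → l ≠ k → L l = 0)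
    (hcond : 40 * (i + 1) * (j + k) + 12 * j * (j + 1) ≤ j * k)
    {N : ℕ} {KL : ℕ → ℕ → ℕ → ℝ}
    (hKL : ∀ k n l, KL k n l = if 0 < k ∧ k < K ∧ l < k then L k * h (n + k) ^ 3 / 2 * ∏ t ∈ Ico (n + 1 + l) (n + k + 1), g t else 0)
    {KA : ℕ → ℕ → ℕ → ℝ} {RA : ℕ → (ℕ → ℝ) → ℕ → ℝ}
    (hRA : ∀ i v m, RA i v m = ∑ l ∈ range K, KA i m l * v (m + 1 + l))
    (hKA : ∀ i m l, KA i m l = KL i m l + KA (i + 1) m l) (hKAtop : ∀ m l, KA K m l = 0)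
    {e ε : ℕ → ℝ} (he0 : ∀ m, 0 ≤ e m) (hea : ∀ m, e (m + 1) ≤ e m)
    (hεt : ∀ m, N < m → ε m = 0) (hεrec : ∀ m, ε m = e m - RA 1 ε m) : ∀ m, 0 ≤ ε m ∧ ε m ≤ e m := by
  have hpos : ∀ n, 0 < h n := fun n => (hh n).1
  have hiK : i < K := by omega
  have hjK : j < K := by omega
  have hj : 0 < j := by omega
  have hk : 0 < k := by omega
  have hK : 1 ≤ K := by omega
  have hL0 : L 0 = 0 := hL3 0 (by omega) (by omega) (by omega) (by omega)
  have hs2 : Real.sqrt 2 ^ 2 = 2 := Real.sq_sqrt (by norm_num)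
  have hs0 : 0 ≤ Real.sqrt 2 := Real.sqrt_nonneg 2
  have hs17 : Real.sqrt 2 ≤ 17 / 12 := Real.sqrt_le_iff.mpr ⟨by norm_num, by norm_num⟩
  have hnum := nested_numerics_moment (i := i) hj hk hcond
  have hea' : ∀ p q, p ≤ q → e q ≤ e p := by
    intro p q hpq
    induction q, hpq using Nat.le_induction with
    | base => exact le_rfl
    | succ q _ ih => exact (hea q).trans ih
  -- the aggregate row is the young row plus the middle row plus the old row
  have hKA1 : ∀ m l, KA 1 m l = KL i m l + (KL j m l + KL k m l) := by
    intro m l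
    have h1 : KA 1 m l = ∑ k' ∈ Ico 1 (K - 1 + 1), KL k' m l :=
      aggregate_eq_sum (n := K - 1) hKA (fun m l => by rw [Nat.sub_add_cancel hK]; exact hKAtop m l) (show 1 ≤ K - 1 + 1 by omega) m l
    rw [h1, Nat.sub_add_cancel hK]
    have hsub : ({i, j, k} : Finset ℕ) ⊆ Ico 1 K := by
      intro x hx
      simp only [mem_insert, mem_singleton] at hx
      rw [mem_Ico]; rcases hx with rfl | rfl | rfl <;> omega
    rw [← sum_subset hsub (fun x hx hxn => by
      simp only [mem_insert, mem_singleton, not_or] at hxn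
      rw [hKL]
      split_ifs
      · rw [hL3 x (mem_Ico.mp hx).2 hxn.1 hxn.2.1 hxn.2.2]; simp
      · rfl), sum_insert (by simp only [mem_insert, mem_singleton]; omega), sum_pair (by omega)]
  have hrec3 : ∀ p, ε p = e p - ∑ l ∈ range K, KL i p l * ε (p + 1 + l)
      - (∑ l ∈ range K, KL j p l * ε (p + 1 + l) + ∑ l ∈ range K, KL k p l * ε (p + 1 + l)) := by
    intro p
    rw [hεrec p, hRA]
    have : ∑ l ∈ range K, KA 1 p l * ε (p + 1 + l) = ∑ l ∈ range K, KL i p l * ε (p + 1 + l)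
        + (∑ l ∈ range K, KL j p l * ε (p + 1 + l) + ∑ l ∈ range K, KL k p l * ε (p + 1 + l)) := by
      rw [← sum_add_distrib, ← sum_add_distrib]; exact sum_congr rfl fun l _ => by rw [hKA1]; ring
    rw [this]; ring
  refine renewal_bounds_of_step he0 hεt fun m IH => ?_
  have hread0 : ∀ a p, m ≤ p → 0 ≤ ∑ l ∈ range K, KL a p l * ε (p + 1 + l) := fun a p hp =>
    sum_nonneg fun l _ => mul_nonneg (kernel_entry_le hL hh hg hKL a p l).1 (IH _ (by omega)).1
  have hreadle : ∀ {a : ℕ}, a < K → ∑ l ∈ range K, KL a m l * ε (m + 1 + l) ≤ (a : ℝ) * (L a * h (m + a) ^ 3 / 2) * e m := by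
    intro a haK
    calc ∑ l ∈ range K, KL a m l * ε (m + 1 + l) ≤ ∑ l ∈ range K, KL a m l * e m :=
          sum_le_sum fun l _ => mul_le_mul_of_nonneg_left
            (((IH _ (by omega)).2).trans (hea' m (m + 1 + l) (by omega))) (kernel_entry_le hL hh hg hKL a m l).1
      _ = (∑ l ∈ range K, KL a m l) * e m := by rw [sum_mul]
      _ ≤ (a : ℝ) * (L a * h (m + a) ^ 3 / 2) * e m := mul_le_mul_of_nonneg_right (row_mass_le hL hh hg hKL haK m) (he0 m)
  have hxj := window_load_le_sqrt_two_div_two hmono hL hb hlo hdom hh hf hjK m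
  have hxk := window_load_le_sqrt_two_div_two hmono hL hb hlo hdom hh hf hkK m
  have hxi := window_load_le_sqrt_two_div_two hmono hL hb hlo hdom hh hf hiK m
  set ci := L i * h (m + i) ^ 3 / 2 with hci_def
  set cj := L j * h (m + j) ^ 3 / 2 with hcj_def
  set ck := L k * h (m + k) ^ 3 / 2 with hck_def
  have hci0 : 0 ≤ ci := by have := hL i; have := hpos (m + i); positivity
  have hcj0 : 0 ≤ cj := by have := hL j; have := hpos (m + j); positivity
  have hck0 : 0 ≤ ck := by have := hL k; have := hpos (m + k); positivity
  have hem := he0 m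
  have hir : (1 : ℝ) ≤ i := by exact_mod_cast hi
  have hjr : (0 : ℝ) < j := by exact_mod_cast hj
  have hkr : (0 : ℝ) < k := by exact_mod_cast hk
  have hc0 : 0 ≤ 1 - Real.sqrt 2 / 2 := by linarith [hs17]
  -- two loads: x ≤ √2∕2 and a·c ≤ √2∕2 give 2·x·c ≤ 1∕a
  have hprod : ∀ {x c a : ℝ}, 0 < a → 0 ≤ x → x ≤ Real.sqrt 2 / 2 → 0 ≤ c → a * c ≤ Real.sqrt 2 / 2 → 2 * x * c ≤ 1 / a := by
    intro x c a ha hx0 hx hc0' hac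
    rw [le_div_iff₀ ha]
    have h1 : x * (a * c) ≤ Real.sqrt 2 / 2 * (Real.sqrt 2 / 2) := mul_le_mul hx hac (by positivity) (by positivity)
    nlinarith [hs2]
  -- STEP 1 (old residual): e − O ≥ (1 − √2∕2)·e ≥ 0
  have hOle : ∑ l ∈ range K, KL k m l * ε (m + 1 + l) ≤ (k : ℝ) * ck * e m := hreadle hkK
  have hres1 : (1 - Real.sqrt 2 / 2) * e m ≤ e m - ∑ l ∈ range K, KL k m l * ε (m + 1 + l) := by
    have := mul_le_mul_of_nonneg_right hxk hem
    linarith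
  have hres1' : 0 ≤ e m - ∑ l ∈ range K, KL k m l * ε (m + 1 + l) := le_trans (mul_nonneg hc0 hem) hres1
  -- STEP 2 (middle against old, first moment): variation 4c_k per lag against Σ_l KL j m l (l+1) ≤ c_j·j(j+1)∕2
  have hstep2 := residual_step_moment (i := j) (Kw := K) (m := m) (sy := Real.sqrt 2 / 2) (V := 4 * ck) (M₁ := cj * ((j : ℝ) * ((j : ℝ) + 1) / 2))
    (wy := fun l => KL j m l) (O := fun p => ∑ l ∈ range K, KL k p l * ε (p + 1 + l)) (e := e) (ε := ε)
    (fun l => (kernel_entry_le hL hh hg hKL j m l).1) (fun l hl => by rw [hKL, if_neg (by omega)])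
    ((row_mass_le hL hh hg hKL hjK m).trans hxj) (row_moment_le hL hh hg hKL hjK m) (by positivity) he0 hea
    (fun q hq => by
      have := hrec3 q
      have h1 := hread0 i q hq.le
      have h2 := hread0 j q hq.le
      linarith)
    hres1'
    (fun d hd1 hdj => by
      have hdk : d ≤ k := by omega
      have hv := old_read_variation hmono hL hb hlo hdom hh hf hL0 hg hgF hKL hk hkK hd1 hdk he0 hea IH
      rw [← hck_def] at hv
      linarith [hv])
  -- the middle residual: e − O − M ≥ [(1 − √2∕2)² − (j+1)∕k]·e ≥ 0
  have hmid : cj * ((j : ℝ) * ((j : ℝ) + 1) / 2) * (4 * ck) ≤ ((j : ℝ) + 1) / k := by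
    -- = 2·(j c_j)·c_k·(j+1) ≤ (1∕k)(j+1)
    have h1 : 2 * ((j : ℝ) * cj) * ck ≤ 1 / k := hprod hkr (by positivity) hxj hck0 hxk
    have h2 : (0 : ℝ) ≤ (j : ℝ) + 1 := by positivity
    calc cj * ((j : ℝ) * ((j : ℝ) + 1) / 2) * (4 * ck) = (2 * ((j : ℝ) * cj) * ck) * ((j : ℝ) + 1) := by ring
      _ ≤ 1 / k * ((j : ℝ) + 1) := mul_le_mul_of_nonneg_right h1 h2
      _ = ((j : ℝ) + 1) / k := by ring
  have hres2 : ((1 - Real.sqrt 2 / 2) ^ 2 - ((j : ℝ) + 1) / k) * e m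
      ≤ e m - (∑ l ∈ range K, KL j m l * ε (m + 1 + l) + ∑ l ∈ range K, KL k m l * ε (m + 1 + l)) := by
    have h1 : (1 - Real.sqrt 2 / 2) * ((1 - Real.sqrt 2 / 2) * e m) ≤ (1 - Real.sqrt 2 / 2) * (e m - ∑ l ∈ range K, KL k m l * ε (m + 1 + l)) :=
      mul_le_mul_of_nonneg_left hres1 hc0
    have h3 : cj * ((j : ℝ) * ((j : ℝ) + 1) / 2) * (4 * ck) * e m ≤ ((j : ℝ) + 1) / k * e m := mul_le_mul_of_nonneg_right hmid hem
    linarith [hstep2, h1, h3]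
  have hρ2 : 0 ≤ (1 - Real.sqrt 2 / 2) ^ 2 - ((j : ℝ) + 1) / k := by
    have hc : (40 : ℝ) * (i + 1) * (j + k) + 12 * j * (j + 1) ≤ j * k := by exact_mod_cast hcond
    have hjk12 : 12 * ((j : ℝ) + 1) ≤ k := by
      have h0 : (0 : ℝ) ≤ 40 * ((i : ℝ) + 1) * ((j : ℝ) + k) := by positivity
      have h1 : (j : ℝ) * (12 * ((j : ℝ) + 1)) ≤ (j : ℝ) * k := by linarith
      exact le_of_mul_le_mul_left h1 hjr
    have h12 : ((j : ℝ) + 1) / k ≤ 1 / 12 := by rw [div_le_iff₀ hkr]; linarith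
    have h7 : (7 : ℝ) / 24 ≤ 1 - Real.sqrt 2 / 2 := by linarith [hs17]
    have h49 : ((7 : ℝ) / 24) ^ 2 ≤ (1 - Real.sqrt 2 / 2) ^ 2 := pow_le_pow_left₀ (by norm_num) h7 2
    nlinarith [h49, h12]
  have hres2' : 0 ≤ e m - (∑ l ∈ range K, KL j m l * ε (m + 1 + l) + ∑ l ∈ range K, KL k m l * ε (m + 1 + l)) :=
    le_trans (mul_nonneg hρ2 hem) hres2
  -- STEP 3 (young against both, first moment): variation 4(c_j + c_k) per lag against Σ_l KL i m l (l+1) ≤ c_i·i(i+1)∕2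
  have hstep3 := residual_step_moment (i := i) (Kw := K) (m := m) (sy := Real.sqrt 2 / 2) (V := 4 * (cj + ck))
    (M₁ := ci * ((i : ℝ) * ((i : ℝ) + 1) / 2)) (wy := fun l => KL i m l)
    (O := fun p => ∑ l ∈ range K, KL j p l * ε (p + 1 + l) + ∑ l ∈ range K, KL k p l * ε (p + 1 + l)) (e := e) (ε := ε)
    (fun l => (kernel_entry_le hL hh hg hKL i m l).1) (fun l hl => by rw [hKL, if_neg (by omega)])
    ((row_mass_le hL hh hg hKL hiK m).trans hxi) (row_moment_le hL hh hg hKL hiK m) (by positivity) he0 hea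
    (fun q hq => by
      have := hrec3 q
      have h1 := hread0 i q hq.le
      linarith)
    hres2'
    (fun d hd1 hdi => by
      have hdj : d ≤ j := by omega
      have hdk : d ≤ k := by omega
      have hvj := old_read_variation hmono hL hb hlo hdom hh hf hL0 hg hgF hKL hj hjK hd1 hdj he0 hea IH
      have hvk := old_read_variation hmono hL hb hlo hdom hh hf hL0 hg hgF hKL hk hkK hd1 hdk he0 hea IH
      rw [← hcj_def] at hvj
      rw [← hck_def] at hvk
      linarith [hvj, hvk])
  -- the young correction: c_i·i(i+1)∕2 · 4(c_j + c_k) ≤ (i+1)(1∕j + 1∕k)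
  have hyoung : ci * ((i : ℝ) * ((i : ℝ) + 1) / 2) * (4 * (cj + ck)) ≤ ((i : ℝ) + 1) / j + ((i : ℝ) + 1) / k := by
    have hxi' : (i : ℝ) * ci ≤ Real.sqrt 2 / 2 := hxi
    have hi0 : (0 : ℝ) ≤ (i : ℝ) * ci := by positivity
    have h1 : 2 * ((i : ℝ) * ci) * cj ≤ 1 / j := hprod hjr hi0 hxi' hcj0 hxj
    have h2 : 2 * ((i : ℝ) * ci) * ck ≤ 1 / k := hprod hkr hi0 hxi' hck0 hxk
    have h3 : (0 : ℝ) ≤ (i : ℝ) + 1 := by positivity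
    calc ci * ((i : ℝ) * ((i : ℝ) + 1) / 2) * (4 * (cj + ck))
        = (2 * ((i : ℝ) * ci) * cj + 2 * ((i : ℝ) * ci) * ck) * ((i : ℝ) + 1) := by ring
      _ ≤ (1 / j + 1 / k) * ((i : ℝ) + 1) := mul_le_mul_of_nonneg_right (add_le_add h1 h2) h3
      _ = ((i : ℝ) + 1) / j + ((i : ℝ) + 1) / k := by ring
  have hεm : ε m = e m - ∑ l ∈ range K, KL i m l * ε (m + 1 + l)
      - (∑ l ∈ range K, KL j m l * ε (m + 1 + l) + ∑ l ∈ range K, KL k m l * ε (m + 1 + l)) := hrec3 m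
  refine ⟨?_, ?_⟩
  · have h1 : (1 - Real.sqrt 2 / 2) * (((1 - Real.sqrt 2 / 2) ^ 2 - ((j : ℝ) + 1) / k) * e m)
        ≤ (1 - Real.sqrt 2 / 2) * (e m - (∑ l ∈ range K, KL j m l * ε (m + 1 + l) + ∑ l ∈ range K, KL k m l * ε (m + 1 + l))) :=
      mul_le_mul_of_nonneg_left hres2 hc0
    have h3 : ci * ((i : ℝ) * ((i : ℝ) + 1) / 2) * (4 * (cj + ck)) * e m ≤ (((i : ℝ) + 1) / j + ((i : ℝ) + 1) / k) * e m :=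
      mul_le_mul_of_nonneg_right hyoung hem
    have h4 : 0 ≤ ((1 - Real.sqrt 2 / 2) ^ 3 - (1 - Real.sqrt 2 / 2) * (((j : ℝ) + 1) / k) - ((i : ℝ) + 1) / j - ((i : ℝ) + 1) / k) * e m :=
      mul_nonneg hnum hem
    rw [hεm]
    linarith [hstep3, h1, h3, h4]
  · rw [hεm]
    linarith [hread0 i m le_rfl, hread0 j m le_rfl, hread0 k m le_rfl]

/-- **THE CENSUS THREE AGES IN THE SHARPENED WEDGE: `80(k₂ + k₃) + 12k₂(k₂+1) ≤ k₂k₃`** (e.g. `k₂ ≥ 100`, `k₃ ≥ 65k₂`; `k₂ ≥ 230`, `k₃ ≥ 19k₂ + 19`;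
`k₂ → ∞`: `k₃ ≥ 12(k₂+1)`): `0 ≤ ε ≤ e` for every admissible excess, every horizon, every damping of the self-consistent class. [folklore] -/
theorem flow_nonneg_census_three_ages_nested_moment (hmono : ∀ u v : ℕ → ℝ, SeqBox γ u → SeqBox γ v → (∀ j, u j ≤ v j) → B u ≤ B v)
    (hL : ∀ k, 0 ≤ L k) (hb : 0 < b) (hlo : ∀ u, SeqBox γ u → b ≤ B u) (hdom : ∀ u, SeqBox γ u → ∑ k ∈ range K, L k * u k ≤ B u)
    (hh : SeqBox γ h) (hf : MemFlow B gIR h) (hg : ∀ t, 0 < g t ∧ g t ≤ 1)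
    (hgF : ∀ t, 1 ≤ g t * (1 + ∑ k ∈ range K, L k * h (t + k) ^ 3 / 2))
    {k₂ k₃ : ℕ} (hk2 : 2 ≤ k₂) (hk23 : k₂ < k₃) (hk3K : k₃ < K) (hL3 : ∀ j, j < K → j ≠ 1 → j ≠ k₂ → j ≠ k₃ → L j = 0)
    (hcond : 80 * (k₂ + k₃) + 12 * k₂ * (k₂ + 1) ≤ k₂ * k₃)
    {N : ℕ} {KL : ℕ → ℕ → ℕ → ℝ}
    (hKL : ∀ k n l, KL k n l = if 0 < k ∧ k < K ∧ l < k then L k * h (n + k) ^ 3 / 2 * ∏ t ∈ Ico (n + 1 + l) (n + k + 1), g t else 0)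
    {KA : ℕ → ℕ → ℕ → ℝ} {RA : ℕ → (ℕ → ℝ) → ℕ → ℝ}
    (hRA : ∀ i v m, RA i v m = ∑ l ∈ range K, KA i m l * v (m + 1 + l))
    (hKA : ∀ i m l, KA i m l = KL i m l + KA (i + 1) m l) (hKAtop : ∀ m l, KA K m l = 0)
    {e ε : ℕ → ℝ} (he0 : ∀ m, 0 ≤ e m) (hea : ∀ m, e (m + 1) ≤ e m)
    (hεt : ∀ m, N < m → ε m = 0) (hεrec : ∀ m, ε m = e m - RA 1 ε m) : ∀ m, 0 ≤ ε m ∧ ε m ≤ e m :=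
  flow_nonneg_three_ages_nested_moment hmono hL hb hlo hdom hh hf hg hgF (i := 1) le_rfl (by omega) hk23 hk3K hL3
    (by simpa using hcond)
    hKL hRA hKA hKAtop he0 hea hεt hεrec

/-! ## §3 The census three ages at every old ratio once the middle age is old -/

/-- **THE CENSUS THREE AGES `{1, k₂, k₃}` WITH `k₂ ≥ 230`: THE END FOR EVERY OLD AGE `k₃ > k₂` — ALONG EVERY ADMISSIBLE FLOW, EVERY HORIZON, EVERY
DAMPING OF THE SELF-CONSISTENT CLASS, NO DISPLAYED MARGIN, WHATEVER THE TOTAL LOAD.**  `k₃ + 1 ≤ 19(k₂+1)`: (E92b)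
`flow_nonneg_census_three_ages_ratio_le` (wedge R1 discharged by the pair share bound); `k₃ ≥ 19(k₂+1)`: `flow_nonneg_census_three_ages_nested_moment`
(`(k₃ − 19k₂ − 19)(k₂ − 80) ≥ 0` and `(k₂ − 230)(7k₂ + 17) ≥ 0` give `80(k₂+k₃) + 12k₂(k₂+1) ≤ k₂k₃`). [folklore] -/
theorem flow_nonneg_census_three_ages_old_middle (hmono : ∀ u v : ℕ → ℝ, SeqBox γ u → SeqBox γ v → (∀ j, u j ≤ v j) → B u ≤ B v)
    (hL : ∀ k, 0 ≤ L k) (hb : 0 < b) (hlo : ∀ u, SeqBox γ u → b ≤ B u) (hdom : ∀ u, SeqBox γ u → ∑ k ∈ range K, L k * u k ≤ B u)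
    (hh : SeqBox γ h) (hf : MemFlow B gIR h) (hg : ∀ t, 0 < g t ∧ g t ≤ 1)
    (hgF : ∀ t, 1 ≤ g t * (1 + ∑ k ∈ range K, L k * h (t + k) ^ 3 / 2))
    {k₂ k₃ : ℕ} (hk2 : 230 ≤ k₂) (hk23 : k₂ < k₃) (hk3K : k₃ < K) (hL3 : ∀ j, j < K → j ≠ 1 → j ≠ k₂ → j ≠ k₃ → L j = 0)
    {N : ℕ} {KL : ℕ → ℕ → ℕ → ℝ}
    (hKL : ∀ k n l, KL k n l = if 0 < k ∧ k < K ∧ l < k then L k * h (n + k) ^ 3 / 2 * ∏ t ∈ Ico (n + 1 + l) (n + k + 1), g t else 0)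
    {KA : ℕ → ℕ → ℕ → ℝ} {RA : ℕ → (ℕ → ℝ) → ℕ → ℝ}
    (hRA : ∀ i v m, RA i v m = ∑ l ∈ range K, KA i m l * v (m + 1 + l))
    (hKA : ∀ i m l, KA i m l = KL i m l + KA (i + 1) m l) (hKAtop : ∀ m l, KA K m l = 0)
    {e ε : ℕ → ℝ} (he0 : ∀ m, 0 ≤ e m) (hea : ∀ m, e (m + 1) ≤ e m)
    (hεt : ∀ m, N < m → ε m = 0) (hεrec : ∀ m, ε m = e m - RA 1 ε m) : ∀ m, 0 ≤ ε m ∧ ε m ≤ e m := by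
  by_cases hratio : k₃ + 1 ≤ 19 * (k₂ + 1)
  · exact flow_nonneg_census_three_ages_ratio_le hmono hL hb hlo hdom hh hf hg hgF hk2 hk23 hk3K hratio hL3 hKL hRA hKA hKAtop he0 hea hεt hεrec
  · have hfar : 19 * (k₂ + 1) ≤ k₃ := by omega
    refine flow_nonneg_census_three_ages_nested_moment hmono hL hb hlo hdom hh hf hg hgF (by omega) hk23 hk3K hL3 ?_ hKL hRA hKA hKAtop
      he0 hea hεt hεrec
    have hk2r : (230 : ℝ) ≤ k₂ := by exact_mod_cast hk2
    have hk3r : (19 : ℝ) * (k₂ + 1) ≤ k₃ := by exact_mod_cast hfar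
    have hA := mul_nonneg (sub_nonneg.2 hk3r) (show (0 : ℝ) ≤ (k₂ : ℝ) - 80 by linarith)
    have hB := mul_nonneg (show (0 : ℝ) ≤ (k₂ : ℝ) - 230 by linarith) (show (0 : ℝ) ≤ 7 * (k₂ : ℝ) + 17 by linarith)
    have hreal : (80 : ℝ) * (k₂ + k₃) + 12 * k₂ * (k₂ + 1) ≤ k₂ * k₃ := by nlinarith [hA, hB]
    exact_mod_cast hreal

end Summit.QuantumFields.BalabanUV.Beta.EriceRemainderEnclosureHistoryAutonomyComparisonAgeCompositionNestedMoments

end
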